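import Summits.QuantumFields.YangMills.Theorems.BalabanUVNodesN19FixedTestArcChains

/-!
# YM-DAG node N19 (= NE7 proper) — FIXED OBSERVABLES UNDER THE UNIFORM-MOMENT CURRENCY, IV: law pairs and arc chains at every scale `|s| ≤ 1`;
# the half-scale Chebyshev-arc laws WITH their two structural identities

Cell `pub-ymgap`, HUMAN RULING D-0062 (Track A) ∕ D-0149 (work-bound push), R141 (C) wider-strategy seat `pub-ymgap-dag-n19-e` (strategy s3 =
ALTERNATIVE CURRENCY), generation g24, module 4 (lineage module 88; part III = module 87 `…N19FixedTestArcChains`, part V = module 89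
`…N19UniformMomentsFixedTestsSummable`).  Route `Summits/QuantumFields/YangMills/Theses/BalabanUVNodes.lean` rev 25, cluster item K3⁷
«SpineGivenEndpointR13SepCoPH» (stmt-QuantumFields-20544); filed `--supports` that item `--as helper` (it proves no registered stub).  COUNT-NEUTRAL:
[folklore] real analysis over Mathlib (`Measure.map`, `integral_map`, `Finset.sum_comp`) + module 87 (`sum_range_abs_altArc_le`), module 78
(`exists_chebyshevArc_laws_alt`) and module 71 (`alt_sum_integral_pow_eq_zero`, `sum_arcLength`, `node_succ_lt`) BY NAME; no scheme object, no Theses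
import; NOT a discharge claim.

§1 SCALED TESTS: `x ↦ G(sx)` with `|s| ≤ 1` is again continuous, `K`-Lipschitz and `B`-bounded on `[−1,1]`.
§2 LAW PAIRS ∕ ARC CHAINS.  `sum_abs_lawPair_increments_le`: if `∫f dP_n − ∫f dQ_n = Σ_{k<n}(−1)^k∫_{x_{k+1}}^{x_k} f(sx)dx` for continuous `f`, then for
every FIXED test `Σ_{n<N}|∫G dP_n − ∫G dQ_n| ≤ (π³∕6)(K+B)` (module 87 §2 at `G∘(s·)`); ★ `sum_abs_increments_arcChain_le`: if moreover
`∫f dP_n + ∫f dQ_n = ∫_{−1}^{1} f(sx)dx`, then along ANY chain `Λ_K ∈ {P_K, Q_K}` (selector `σ`) whose step-`K` candidates are the arc laws of level `lev K`, each level visited at most `m`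
times (`#{K<L : lev K = n} ≤ m`), `Σ_{K<L}|∫G dΛ_{K+1} − ∫G dΛ_K| ≤ m(π³∕6)(K+B)`: each candidate integrates `G` to `½(∫_{−1}^{1}G(s·) ± A_{lev K})`,
so an increment is `≤ ½(|A_{lev K}| + |A_{lev(K+1)}|)`; regroup by level (`Finset.sum_comp`).  The identities are required only ALONG THE CHAIN.
§3 ★★ `exists_halfScale_chebyshevArc_laws_ident`: module 78's half-scale arc laws (`n ≥ 3`; probability laws on `[−1,1]`, moments `j ≤ n−2` EQUAL to
`β_j = ½∫_{−1}^{1}(x∕2)^j`, ALL moments within `2(½)^n` of `β`, a `1`-Lipschitz `1∕(4n)`-bounded test paid `1∕(4n)` EXACTLY) RE-EXPORTED TOGETHER WITH the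
two structural identities at scale `s = ½` (`∫f dP' − ∫f dQ' = Σ_k(−1)^k∫_{x_{k+1}}^{x_k} f(x∕2)dx`, `∫f dP' + ∫f dQ' = ∫_{−1}^{1} f(x∕2)dx`), which module
78's export omitted and §2 consumes; the proof is module 78's (images under `x ↦ x∕2` of `exists_chebyshevArc_laws_alt`).

HONEST FRAMING (binding).  Elementary and [folklore]; toy laws, no scheme object; NO consumer in the DAG today (a structural statement about the seat's own
currencies); nothing of Bałaban's instantiated; NE7 NOT PRINTED, NOT proved; N19 NOT discharged; count-neutral.  One finite `T⁴` programme at fixed `ε`;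
nothing continuum ∕ `ℝ⁴` ∕ OS ∕ mass-gap ∕ Clay.  0 `def` ∕ 0 `sorry`.
-/

noncomputable section

open Real Finset MeasureTheory ProbabilityTheory Polynomial.Chebyshev

namespace Summit.QuantumFields.YangMills.Theorems.BalabanUVNodesN19FixedTestLawPairs

open Summit.QuantumFields.YangMills.Theorems.BalabanUVNodesN19FixedTestArcChains
open Summit.QuantumFields.YangMills.Theorems.BalabanUVNodesN19ChebyshevArcFunctional (node_succ_lt sum_arcLength alt_sum_integral_pow_eq_zero)
open Summit.QuantumFields.YangMills.Theorems.BalabanUVNodesN19UniformMomentSummabilityThreshold (exists_chebyshevArc_laws_alt)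

variable {G : ℝ → ℝ} {K B s : ℝ}

/-! ## §1 Scaled tests [bookkeeping] -/

/-- `x ↦ G(sx)` (`|s| ≤ 1`) is `K`-Lipschitz on `[−1,1]` when `G` is. [bookkeeping] -/
theorem lip_comp_scale (hs : |s| ≤ 1)
    (hK : ∀ x y : ℝ, x ∈ Set.Icc (-1 : ℝ) 1 → y ∈ Set.Icc (-1 : ℝ) 1 → |G x - G y| ≤ K * |x - y|) :
    ∀ x y : ℝ, x ∈ Set.Icc (-1 : ℝ) 1 → y ∈ Set.Icc (-1 : ℝ) 1 → |G (s * x) - G (s * y)| ≤ K * |x - y| := by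
  intro x y hx hy
  have hmem : ∀ t ∈ Set.Icc (-1 : ℝ) 1, s * t ∈ Set.Icc (-1 : ℝ) 1 := fun t ht => by
    have h1 : |s * t| ≤ 1 := by rw [abs_mul]; exact mul_le_one₀ hs (abs_nonneg t) (abs_le.2 ⟨ht.1, ht.2⟩)
    exact ⟨(abs_le.1 h1).1, (abs_le.1 h1).2⟩
  refine (hK _ _ (hmem x hx) (hmem y hy)).trans ?_
  rw [← mul_sub, abs_mul]
  exact mul_le_mul_of_nonneg_left (mul_le_of_le_one_left (abs_nonneg _) hs) (lipConst_nonneg hK)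

/-- `x ↦ G(sx)` (`|s| ≤ 1`) is `B`-bounded on `[−1,1]` when `G` is. [bookkeeping] -/
theorem bound_comp_scale (hs : |s| ≤ 1) (hB : ∀ x : ℝ, x ∈ Set.Icc (-1 : ℝ) 1 → |G x| ≤ B) :
    ∀ x : ℝ, x ∈ Set.Icc (-1 : ℝ) 1 → |G (s * x)| ≤ B := fun x hx => by
  have h1 : |s * x| ≤ 1 := by rw [abs_mul]; exact mul_le_one₀ hs (abs_nonneg x) (abs_le.2 ⟨hx.1, hx.2⟩)
  exact hB _ ⟨(abs_le.1 h1).1, (abs_le.1 h1).2⟩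

/-- The level sums of the alternating arc functional of a scaled test are `≤ (π³∕6)(K+B)` (module 87 §2 at `G∘(s·)`). [folklore] -/
theorem sum_range_abs_altArc_scale_le (hs : |s| ≤ 1) (hG : Continuous G)
    (hK : ∀ x y : ℝ, x ∈ Set.Icc (-1 : ℝ) 1 → y ∈ Set.Icc (-1 : ℝ) 1 → |G x - G y| ≤ K * |x - y|)
    (hB : ∀ x : ℝ, x ∈ Set.Icc (-1 : ℝ) 1 → |G x| ≤ B) (N : ℕ) :
    ∑ n ∈ Finset.range N, |∑ k ∈ Finset.range n, (-1 : ℝ) ^ k * ∫ x in node n (k + 1)..node n k, G (s * x)| ≤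
      π ^ 3 / 6 * (K + B) :=
  sum_range_abs_altArc_le (G := fun x => G (s * x)) (hG.comp (continuous_const.mul continuous_id))
    (lip_comp_scale hs hK) (bound_comp_scale hs hB) N

/-! ## §2 Law pairs and arc chains [folklore] -/

/-- **LAW PAIRS.**  If for every level the pair `(P_n, Q_n)` satisfies module 72's difference identity at scale `s` (`|s| ≤ 1`),
`∫f dP_n − ∫f dQ_n = Σ_{k<n}(−1)^k∫_{x_{k+1}}^{x_k} f(sx)dx`, then for every FIXED continuous `K`-Lipschitz `B`-bounded test `G` on `[−1,1]`:
`Σ_{n<N} |∫G dP_n − ∫G dQ_n| ≤ (π³∕6)(K+B)` — although along the level-`n` tests the pairs stay `≍ 1∕n` apart (modules 72∕78). [folklore] -/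
theorem sum_abs_lawPair_increments_le {P Q : ℕ → Measure ℝ} (hs : |s| ≤ 1)
    (hPQ : ∀ (n : ℕ) (f : ℝ → ℝ), Continuous f →
      ∫ x, f x ∂P n - ∫ x, f x ∂Q n = ∑ k ∈ Finset.range n, (-1 : ℝ) ^ k * ∫ x in node n (k + 1)..node n k, f (s * x))
    (hG : Continuous G)
    (hK : ∀ x y : ℝ, x ∈ Set.Icc (-1 : ℝ) 1 → y ∈ Set.Icc (-1 : ℝ) 1 → |G x - G y| ≤ K * |x - y|)
    (hB : ∀ x : ℝ, x ∈ Set.Icc (-1 : ℝ) 1 → |G x| ≤ B) (N : ℕ) :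
    ∑ n ∈ Finset.range N, |∫ x, G x ∂P n - ∫ x, G x ∂Q n| ≤ π ^ 3 / 6 * (K + B) := by
  simp_rw [hPQ _ G hG]
  exact sum_range_abs_altArc_scale_le hs hG hK hB N

/-- ★ **ARC CHAINS.**  Let `Λ_K` be, at each step, one of two candidate laws `P_K, Q_K` (`σ` selects which) which satisfy both structural identities
of module 72 AT THE LEVEL `lev K` and scale `s` (`|s| ≤ 1`): difference = the level-`lev K` alternating arc functional of `f(s·)`, sum = `∫_{−1}^{1}f(s·)`
(so the candidates at step `K` are the two arc laws of level `lev K`).  If every level is visited at most `m` times (`#{K<L : lev K = n} ≤ m` for all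
`n, L`), then for every FIXED continuous `K`-Lipschitz `B`-bounded test `G`:
`Σ_{K<L} |∫G dΛ_{K+1} − ∫G dΛ_K| ≤ m·(π³∕6)(K+B)` — every candidate integrates `G` to `½(∫_{−1}^{1}G(s·) ± A_{lev K})`, so each increment is
`≤ ½(|A_{lev K}| + |A_{lev(K+1)}|)`, and the levels regroup with multiplicity `≤ m` (`Finset.sum_comp`) under module 87's `Σ_n |A_n| ≤ (π³∕6)(K+B)`. [folklore] -/
theorem sum_abs_increments_arcChain_le {P Q : ℕ → Measure ℝ} {lev : ℕ → ℕ} {σ : ℕ → Prop} [DecidablePred σ] {m : ℕ}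
    (hs : |s| ≤ 1)
    (hPQ : ∀ (K : ℕ) (f : ℝ → ℝ), Continuous f →
      ∫ x, f x ∂P K - ∫ x, f x ∂Q K =
        ∑ k ∈ Finset.range (lev K), (-1 : ℝ) ^ k * ∫ x in node (lev K) (k + 1)..node (lev K) k, f (s * x))
    (hPQs : ∀ (K : ℕ) (f : ℝ → ℝ), Continuous f → ∫ x, f x ∂P K + ∫ x, f x ∂Q K = ∫ x in (-1 : ℝ)..1, f (s * x))
    (hm : ∀ n L : ℕ, ((Finset.range L).filter (fun K => lev K = n)).card ≤ m)
    (hG : Continuous G)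
    (hK : ∀ x y : ℝ, x ∈ Set.Icc (-1 : ℝ) 1 → y ∈ Set.Icc (-1 : ℝ) 1 → |G x - G y| ≤ K * |x - y|)
    (hB : ∀ x : ℝ, x ∈ Set.Icc (-1 : ℝ) 1 → |G x| ≤ B) (L : ℕ) :
    ∑ K ∈ Finset.range L, |∫ x, G x ∂(if σ (K + 1) then P (K + 1) else Q (K + 1)) -
        ∫ x, G x ∂(if σ K then P K else Q K)| ≤ m * (π ^ 3 / 6 * (K + B)) := by
  classical
  set A : ℕ → ℝ := fun n => ∑ k ∈ Finset.range n, (-1 : ℝ) ^ k * ∫ x in node n (k + 1)..node n k, G (s * x) with hA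
  set S : ℝ := ∫ x in (-1 : ℝ)..1, G (s * x) with hS
  -- every candidate law integrates `G` to `½(S ± A_{lev K})`
  have hval : ∀ (K : ℕ), ∃ ε : ℝ, (ε = 1 ∨ ε = -1) ∧
      ∫ x, G x ∂(if σ K then P K else Q K) = (S + ε * A (lev K)) / 2 := by
    intro K
    have h1 : ∫ x, G x ∂P K - ∫ x, G x ∂Q K = A (lev K) := hPQ K G hG
    have h2 : ∫ x, G x ∂P K + ∫ x, G x ∂Q K = S := hPQs K G hG
    by_cases hσ : σ K
    · exact ⟨1, Or.inl rfl, by rw [if_pos hσ]; linarith⟩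
    · exact ⟨-1, Or.inr rfl, by rw [if_neg hσ]; linarith⟩
  have hincr : ∀ K : ℕ, |∫ x, G x ∂(if σ (K + 1) then P (K + 1) else Q (K + 1)) -
      ∫ x, G x ∂(if σ K then P K else Q K)| ≤ (|A (lev K)| + |A (lev (K + 1))|) / 2 := by
    intro K
    obtain ⟨ε, hε, e1⟩ := hval (K + 1)
    obtain ⟨ε', hε', e0⟩ := hval K
    have hε1 : |ε| = 1 := by rcases hε with rfl | rfl <;> simp
    have hε'1 : |ε'| = 1 := by rcases hε' with rfl | rfl <;> simp
    rw [e1, e0, show (S + ε * A (lev (K + 1))) / 2 - (S + ε' * A (lev K)) / 2 =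
      (ε * A (lev (K + 1)) + -(ε' * A (lev K))) / 2 by ring, abs_div, abs_two]
    refine div_le_div_of_nonneg_right ((abs_add_le _ _).trans ?_) zero_le_two
    rw [abs_neg, abs_mul, abs_mul, hε1, hε'1, one_mul, one_mul, add_comm]
  -- regroup by level: `Σ_{K<L'} |A_{lev K}| ≤ m · Σ_n |A_n| ≤ m (π³∕6)(K+B)`
  have hsumA : ∀ L' : ℕ, ∑ K ∈ Finset.range L', |A (lev K)| ≤ m * (π ^ 3 / 6 * (K + B)) := by
    intro L'
    rw [Finset.sum_comp (s := Finset.range L') (f := fun n => |A n|) (g := lev)]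
    have hb := sum_range_abs_altArc_scale_le hs hG hK hB
    calc ∑ n ∈ (Finset.range L').image lev, ((Finset.range L').filter (fun K => lev K = n)).card • |A n|
        ≤ ∑ n ∈ (Finset.range L').image lev, (m : ℝ) * |A n| := by
          refine Finset.sum_le_sum fun n _ => ?_
          rw [nsmul_eq_mul]
          exact mul_le_mul_of_nonneg_right (by exact_mod_cast hm n L') (abs_nonneg _)
      _ = m * ∑ n ∈ (Finset.range L').image lev, |A n| := by rw [Finset.mul_sum]
      _ ≤ m * (π ^ 3 / 6 * (K + B)) := by
          refine mul_le_mul_of_nonneg_left ?_ (Nat.cast_nonneg m)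
          obtain ⟨M, hM⟩ : ∃ M : ℕ, (Finset.range L').image lev ⊆ Finset.range M :=
            ⟨((Finset.range L').image lev).sup id + 1, fun n hn =>
              Finset.mem_range.2 (Nat.lt_succ_of_le (Finset.le_sup (f := id) hn))⟩
          exact (Finset.sum_le_sum_of_subset_of_nonneg hM fun n _ _ => abs_nonneg _).trans (hb M)
  calc ∑ K ∈ Finset.range L, |∫ x, G x ∂(if σ (K + 1) then P (K + 1) else Q (K + 1)) -
          ∫ x, G x ∂(if σ K then P K else Q K)|
      ≤ ∑ K ∈ Finset.range L, (|A (lev K)| + |A (lev (K + 1))|) / 2 := Finset.sum_le_sum fun K _ => hincr K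
    _ = (∑ K ∈ Finset.range L, |A (lev K)| + ∑ K ∈ Finset.range L, |A (lev (K + 1))|) / 2 := by
        rw [← Finset.sum_add_distrib, Finset.sum_div]
    _ ≤ (∑ K ∈ Finset.range (L + 1), |A (lev K)| + ∑ K ∈ Finset.range (L + 1), |A (lev K)|) / 2 := by
        have h1 : ∑ K ∈ Finset.range L, |A (lev K)| ≤ ∑ K ∈ Finset.range (L + 1), |A (lev K)| :=
          Finset.sum_le_sum_of_subset_of_nonneg (Finset.range_mono (Nat.le_succ L)) fun K _ _ => abs_nonneg _
        have h2 : ∑ K ∈ Finset.range L, |A (lev (K + 1))| ≤ ∑ K ∈ Finset.range (L + 1), |A (lev K)| := by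
          rw [Finset.sum_range_succ']
          linarith [abs_nonneg (A (lev 0))]
        linarith
    _ ≤ (m * (π ^ 3 / 6 * (K + B)) + m * (π ^ 3 / 6 * (K + B))) / 2 := by linarith [hsumA (L + 1)]
    _ = m * (π ^ 3 / 6 * (K + B)) := by ring

/-! ## §3 The half-scale arc laws with their structural identities [folklore] -/

/-- ★★ **THE HALF-SCALE CHEBYSHEV-ARC LAWS, WITH THE TWO STRUCTURAL IDENTITIES.**  For `n ≥ 3` there are probability laws `P', Q'` on `[−1,1]` (the
images under `x ↦ x∕2` of module 78's `exists_chebyshevArc_laws_alt` laws) such that: (o) for every continuous `f`,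
`∫f dP' − ∫f dQ' = Σ_{k<n}(−1)^k∫_{x_{k+1}}^{x_k} f(x∕2)dx` and `∫f dP' + ∫f dQ' = ∫_{−1}^{1} f(x∕2)dx`; (i) every moment of order `j ≤ n−2` of either
law EQUALS `β_j = ½∫_{−1}^{1}(x∕2)^j dx`; (ii) EVERY moment of either law is within `2(½)^n` of `β_j`; (iii) a continuous `g`, `1`-Lipschitz and
`1∕(4n)`-bounded on `[−1,1]`, is paid `∫g dP' − ∫g dQ' = 1∕(4n)` EXACTLY.  (Module 78's statement plus (o).) [folklore] -/
theorem exists_halfScale_chebyshevArc_laws_ident {n : ℕ} (hn : 3 ≤ n) :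
    ∃ P Q : Measure ℝ, IsProbabilityMeasure P ∧ IsProbabilityMeasure Q ∧
      P (Set.Icc (-1 : ℝ) 1)ᶜ = 0 ∧ Q (Set.Icc (-1 : ℝ) 1)ᶜ = 0 ∧
      (∀ f : ℝ → ℝ, Continuous f →
        ∫ x, f x ∂P - ∫ x, f x ∂Q = ∑ k ∈ range n, (-1 : ℝ) ^ k * ∫ x in node n (k + 1)..node n k, f (1 / 2 * x)) ∧
      (∀ f : ℝ → ℝ, Continuous f → ∫ x, f x ∂P + ∫ x, f x ∂Q = ∫ x in (-1 : ℝ)..1, f (1 / 2 * x)) ∧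
      (∀ j : ℕ, j + 2 ≤ n → ∫ x, x ^ j ∂P = 1 / 2 * ∫ x in (-1 : ℝ)..1, (x / 2) ^ j ∧
        ∫ x, x ^ j ∂Q = 1 / 2 * ∫ x in (-1 : ℝ)..1, (x / 2) ^ j) ∧
      (∀ j : ℕ, |∫ x, x ^ j ∂P - 1 / 2 * ∫ x in (-1 : ℝ)..1, (x / 2) ^ j| ≤ 2 * (1 / 2 : ℝ) ^ n ∧
        |∫ x, x ^ j ∂Q - 1 / 2 * ∫ x in (-1 : ℝ)..1, (x / 2) ^ j| ≤ 2 * (1 / 2 : ℝ) ^ n) ∧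
      ∃ g : ℝ → ℝ, Continuous g ∧
        (∀ x y : ℝ, x ∈ Set.Icc (-1 : ℝ) 1 → y ∈ Set.Icc (-1 : ℝ) 1 → |g x - g y| ≤ 1 * |x - y|) ∧
        (∀ x : ℝ, x ∈ Set.Icc (-1 : ℝ) 1 → |g x| ≤ 1 / (4 * n)) ∧
        ∫ x, g x ∂P - ∫ x, g x ∂Q = 1 / (4 * n) := by
  obtain ⟨P₀, Q₀, iP, iQ, hP₀c, hQ₀c, hsub, hadd, g, hgc, hgL, hgB, hpay⟩ := exists_chebyshevArc_laws_alt hn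
  have hn0 : n ≠ 0 := by omega
  have hnr : (0 : ℝ) < n := by exact_mod_cast Nat.pos_of_ne_zero hn0
  have hmeas : Measurable fun x : ℝ => x / 2 := by fun_prop
  have iP' : IsProbabilityMeasure (P₀.map fun x : ℝ => x / 2) := Measure.isProbabilityMeasure_map hmeas.aemeasurable
  have iQ' : IsProbabilityMeasure (Q₀.map fun x : ℝ => x / 2) := Measure.isProbabilityMeasure_map hmeas.aemeasurable
  have hsupp : ∀ {κ : Measure ℝ}, κ (Set.Icc (-1 : ℝ) 1)ᶜ = 0 → (κ.map fun x : ℝ => x / 2) (Set.Icc (-1 : ℝ) 1)ᶜ = 0 := by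
    intro κ hκ
    rw [Measure.map_apply hmeas measurableSet_Icc.compl]
    refine measure_mono_null (fun x hx => ?_) hκ
    simp only [Set.preimage_compl, Set.mem_compl_iff, Set.mem_preimage, Set.mem_Icc, not_and_or, not_le] at hx ⊢
    rcases hx with h | h
    · left; linarith
    · right; linarith
  have hint : ∀ (κ : Measure ℝ) {f : ℝ → ℝ}, Continuous f → ∫ y, f y ∂(κ.map fun x : ℝ => x / 2) = ∫ x, f (x / 2) ∂κ :=
    fun κ f hf => integral_map hmeas.aemeasurable hf.aestronglyMeasurable
  -- (o) the identities, transported (`x∕2 = ½·x`)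
  have hhalf : ∀ f : ℝ → ℝ, (fun x : ℝ => f (x / 2)) = fun x => f (1 / 2 * x) := fun f => by
    funext x; congr 1; ring
  have hcomp : ∀ {f : ℝ → ℝ}, Continuous f → Continuous fun x : ℝ => f (x / 2) := fun hf => hf.comp (continuous_id.div_const _)
  have hsub' : ∀ f : ℝ → ℝ, Continuous f →
      ∫ y, f y ∂(P₀.map fun x : ℝ => x / 2) - ∫ y, f y ∂(Q₀.map fun x : ℝ => x / 2) =
        ∑ k ∈ range n, (-1 : ℝ) ^ k * ∫ x in node n (k + 1)..node n k, f (1 / 2 * x) := by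
    intro f hf
    rw [hint P₀ hf, hint Q₀ hf, hsub _ (hcomp hf), hhalf f]
  have hadd' : ∀ f : ℝ → ℝ, Continuous f →
      ∫ y, f y ∂(P₀.map fun x : ℝ => x / 2) + ∫ y, f y ∂(Q₀.map fun x : ℝ => x / 2) = ∫ x in (-1 : ℝ)..1, f (1 / 2 * x) := by
    intro f hf
    rw [hint P₀ hf, hint Q₀ hf, hadd _ (hcomp hf), hhalf f]
  -- the arc integrals of `(x∕2)^j`: each at most `(½)^j·(arc length)`; their alternating sum vanishes for `j + 2 ≤ n`
  have hcont : ∀ j : ℕ, Continuous fun x : ℝ => (x / 2) ^ j := fun j => by fun_prop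
  have hterm : ∀ j k : ℕ, k ∈ range n →
      |(-1 : ℝ) ^ k * ∫ x in node n (k + 1)..node n k, (x / 2) ^ j| ≤ (1 / 2 : ℝ) ^ j * (node n k - node n (k + 1)) := by
    intro j k hk
    rw [abs_mul, abs_pow, abs_neg, abs_one, one_pow, one_mul]
    have hlt := node_succ_lt (Finset.mem_range.1 hk)
    have h := intervalIntegral.norm_integral_le_of_norm_le_const (a := node n (k + 1)) (b := node n k)
      (C := (1 / 2 : ℝ) ^ j) (f := fun x : ℝ => (x / 2) ^ j) (fun x hx => by
        rw [Set.uIoc_of_le hlt.le] at hx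
        rw [Real.norm_eq_abs, abs_pow, abs_div, abs_two]
        have h1 : |x| ≤ 1 :=
          abs_le.2 ⟨(node_mem_Icc (n := n) (i := k + 1)).1.trans hx.1.le, hx.2.trans (node_mem_Icc (n := n) (i := k)).2⟩
        exact pow_le_pow_left₀ (by positivity) (by linarith) j)
    rw [Real.norm_eq_abs, abs_of_pos (sub_pos.2 hlt)] at h
    exact h
  have halt_abs : ∀ j : ℕ,
      |∑ k ∈ range n, (-1 : ℝ) ^ k * ∫ x in node n (k + 1)..node n k, (x / 2) ^ j| ≤ 2 * (1 / 2 : ℝ) ^ j := fun j =>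
    calc |∑ k ∈ range n, (-1 : ℝ) ^ k * ∫ x in node n (k + 1)..node n k, (x / 2) ^ j|
        ≤ ∑ k ∈ range n, |(-1 : ℝ) ^ k * ∫ x in node n (k + 1)..node n k, (x / 2) ^ j| := Finset.abs_sum_le_sum_abs _ _
      _ ≤ ∑ k ∈ range n, (1 / 2 : ℝ) ^ j * (node n k - node n (k + 1)) := Finset.sum_le_sum (hterm j)
      _ = 2 * (1 / 2 : ℝ) ^ j := by rw [← Finset.mul_sum, sum_arcLength hn0]; ring
  have halt_zero : ∀ j : ℕ, j + 2 ≤ n →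
      ∑ k ∈ range n, (-1 : ℝ) ^ k * ∫ x in node n (k + 1)..node n k, (x / 2) ^ j = 0 := by
    intro j hj
    have h := alt_sum_integral_pow_eq_zero (n := n) (j := j) hj
    have e : ∀ k : ℕ, (-1 : ℝ) ^ k * ∫ x in node n (k + 1)..node n k, (x / 2) ^ j =
        (1 / 2 : ℝ) ^ j * ((-1 : ℝ) ^ k * ∫ x in node n (k + 1)..node n k, x ^ j) := by
      intro k
      rw [show (∫ x in node n (k + 1)..node n k, (x / 2) ^ j) = (1 / 2 : ℝ) ^ j * ∫ x in node n (k + 1)..node n k, x ^ j by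
        rw [← intervalIntegral.integral_const_mul]
        exact intervalIntegral.integral_congr fun x _ => by ring]
      ring
    simp_rw [e]
    rw [← Finset.mul_sum, h, mul_zero]
  -- the moments against the base `β_j = ½∫(x∕2)^j`: `±½·(alternating sum)`
  have hsubj : ∀ j : ℕ, ∫ y, y ^ j ∂(P₀.map fun x : ℝ => x / 2) - ∫ y, y ^ j ∂(Q₀.map fun x : ℝ => x / 2) =
      ∑ k ∈ range n, (-1 : ℝ) ^ k * ∫ x in node n (k + 1)..node n k, (x / 2) ^ j := fun j => by
    rw [hint P₀ (continuous_pow j), hint Q₀ (continuous_pow j)]; exact hsub _ (hcont j)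
  have haddj : ∀ j : ℕ, ∫ y, y ^ j ∂(P₀.map fun x : ℝ => x / 2) + ∫ y, y ^ j ∂(Q₀.map fun x : ℝ => x / 2) =
      ∫ x in (-1 : ℝ)..1, (x / 2) ^ j := fun j => by
    rw [hint P₀ (continuous_pow j), hint Q₀ (continuous_pow j)]; exact hadd _ (hcont j)
  have hPj : ∀ j : ℕ, ∫ y, y ^ j ∂(P₀.map fun x : ℝ => x / 2) - 1 / 2 * ∫ x in (-1 : ℝ)..1, (x / 2) ^ j =
      1 / 2 * ∑ k ∈ range n, (-1 : ℝ) ^ k * ∫ x in node n (k + 1)..node n k, (x / 2) ^ j := fun j => by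
    have h1 := hsubj j
    have h2 := haddj j
    linarith
  have hQj : ∀ j : ℕ, ∫ y, y ^ j ∂(Q₀.map fun x : ℝ => x / 2) - 1 / 2 * ∫ x in (-1 : ℝ)..1, (x / 2) ^ j =
      -(1 / 2 * ∑ k ∈ range n, (-1 : ℝ) ^ k * ∫ x in node n (k + 1)..node n k, (x / 2) ^ j) := fun j => by
    have h1 := hsubj j
    have h2 := haddj j
    linarith
  have habs_half : ∀ j : ℕ,
      |1 / 2 * ∑ k ∈ range n, (-1 : ℝ) ^ k * ∫ x in node n (k + 1)..node n k, (x / 2) ^ j| ≤ 2 * (1 / 2 : ℝ) ^ n := by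
    intro j
    by_cases hj : j + 2 ≤ n
    · rw [halt_zero j hj, mul_zero, abs_zero]; positivity
    · have hjn : n ≤ j + 1 := by omega
      have hpow : (1 / 2 : ℝ) ^ j ≤ 2 * (1 / 2 : ℝ) ^ n := by
        have h : (1 / 2 : ℝ) ^ (j + 1) ≤ (1 / 2 : ℝ) ^ n := pow_le_pow_of_le_one (by norm_num) (by norm_num) hjn
        rw [pow_succ] at h
        linarith
      rw [abs_mul, abs_of_pos (by norm_num : (0 : ℝ) < 1 / 2)]
      calc 1 / 2 * |∑ k ∈ range n, (-1 : ℝ) ^ k * ∫ x in node n (k + 1)..node n k, (x / 2) ^ j|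
          ≤ 1 / 2 * (2 * (1 / 2 : ℝ) ^ j) := mul_le_mul_of_nonneg_left (halt_abs j) (by norm_num)
        _ = (1 / 2 : ℝ) ^ j := by ring
        _ ≤ 2 * (1 / 2 : ℝ) ^ n := hpow
  -- the clamp `c` and the pulled-back test `y ↦ g(c(2y))∕2`
  set c : ℝ → ℝ := fun t => max (min t 1) (-1) with hcdef
  have hc_mem : ∀ t, c t ∈ Set.Icc (-1 : ℝ) 1 := fun t => ⟨le_max_right _ _, max_le (min_le_right _ _) (by norm_num)⟩
  have hc_id : ∀ t ∈ Set.Icc (-1 : ℝ) 1, c t = t := fun t ht => by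
    simp only [hcdef, min_eq_left ht.2, max_eq_left ht.1]
  have hc_lip : ∀ a b : ℝ, |c a - c b| ≤ |a - b| := fun a b =>
    calc |c a - c b| ≤ |min a 1 - min b 1| := abs_max_sub_max_le_abs _ _ _
      _ ≤ max |a - b| |(1 : ℝ) - 1| := abs_min_sub_min_le_max _ _ _ _
      _ = |a - b| := by rw [sub_self, abs_zero, max_eq_left (abs_nonneg _)]
  have hc_cont : Continuous c := (continuous_id.min continuous_const).max continuous_const
  have hg'c : Continuous fun y : ℝ => g (c (2 * y)) / 2 :=
    (hgc.comp (hc_cont.comp (continuous_const.mul continuous_id))).div_const _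
  -- the test integrals transport back to `½∫g` (the laws live on `[−1,1]`, where the clamp is the identity)
  have hae : ∀ (κ : Measure ℝ), κ (Set.Icc (-1 : ℝ) 1)ᶜ = 0 →
      ∫ x, g (c (2 * (x / 2))) / 2 ∂κ = 1 / 2 * ∫ x, g x ∂κ := by
    intro κ hκ
    rw [← integral_const_mul]
    refine integral_congr_ae ?_
    have h : ∀ᵐ x ∂κ, x ∈ Set.Icc (-1 : ℝ) 1 := by
      rw [ae_iff]
      simpa only [Set.mem_Icc, Set.compl_def] using hκ
    exact h.mono fun x hx => by
      show g (c (2 * (x / 2))) / 2 = 1 / 2 * g x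
      rw [show 2 * (x / 2) = x by ring, hc_id x hx]
      ring
  refine ⟨P₀.map (fun x : ℝ => x / 2), Q₀.map (fun x : ℝ => x / 2), iP', iQ', hsupp hP₀c, hsupp hQ₀c, hsub', hadd',
    fun j hj => ⟨?_, ?_⟩, fun j => ⟨?_, ?_⟩, fun y => g (c (2 * y)) / 2, hg'c, ?_, ?_, ?_⟩
  · have h := hPj j
    rw [halt_zero j hj, mul_zero, sub_eq_zero] at h
    exact h
  · have h := hQj j
    rw [halt_zero j hj, mul_zero, neg_zero, sub_eq_zero] at h
    exact h
  · rw [hPj j]; exact habs_half j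
  · rw [hQj j, abs_neg]; exact habs_half j
  · intro x y _ _
    have h1 := hgL (c (2 * x)) (c (2 * y)) (hc_mem _) (hc_mem _)
    have h2 := hc_lip (2 * x) (2 * y)
    rw [show 2 * x - 2 * y = 2 * (x - y) by ring, abs_mul, abs_two] at h2
    rw [show g (c (2 * x)) / 2 - g (c (2 * y)) / 2 = (g (c (2 * x)) - g (c (2 * y))) / 2 by ring, abs_div, abs_two]
    linarith
  · intro x _
    have h := hgB (c (2 * x)) (hc_mem _)
    rw [abs_div, abs_two, show 1 / (4 * (n : ℝ)) = (1 / (2 * n)) / 2 by field_simp; ring]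
    linarith
  · rw [hint P₀ hg'c, hint Q₀ hg'c, hae P₀ hP₀c, hae Q₀ hQ₀c, ← mul_sub, hpay]
    field_simp
    ring

end Summit.QuantumFields.YangMills.Theorems.BalabanUVNodesN19FixedTestLawPairs

end
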